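import Mathlib
import Summits.ResolutionOfSingularities.ResolutionOfSingularities.Theorems.HomologicalConductorNoZenoSplitLiftModel
import Literature.AlgebraicGeometry.Resolution.Lipman1969FormallySmoothBaseChange
import HarnessLib

/-!
# D2′ PART 4b: the local rings of the split fibre — local-étale germs `D → (D[β])_𝔫`

W4.4 (crux `NoZenoR`, stmt-ResolutionOfSingularities-19943), `stub_L1wCore` route (F1), descent
step (B2) of `L1W-PREP-v2.md` §2.1 (res-L0-w44-stub-2), chart side of `Sig.L1Core`
(res-L0-w44-lead-1).  Over the NEW germ `D' = (nrm B)_𝔮` of the chart the splitting polynomial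
`f` (chosen for the old germ `D`) still has separable reduction, but the reduction may SPLIT over
`κ(D')`: the upstairs ring `D'[β] ≅ D'[X]/(f)` is finite étale over `D'` yet only SEMI-local, and
the upstairs germs of the chart are its local rings `(D'[β])_𝔫`, one for each prime `𝔮_f` over `𝔮`.
This file treats that situation abstractly: `D ⊆ K` a local `k`-subalgebra, `f ∈ D[X]` a monic
model of `g ∈ K[X]` (`f.map = g`) with separable reduction, and `L ⊆ K_g` a local subring which is
«a local ring of `D[β]`»:

  (i) `D[β] ⊆ L`; (ii) every `z ∈ L` is `a·b⁻¹` with `a, b ∈ D[β]`, `b` a unit of `L`;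
  (iii) `D → L` is local (`𝔪_D` goes to non-units).

Then (`fibrePrime`) the non-units of `L` cut out a maximal ideal `𝔫` of `D[X]/(f)`, `L` is the
localisation `(D[X]/(f))_𝔫` (`isLocalization_fibreGerm`, `fibreGermEquiv : (D[X]/(f))_𝔫 ≃ₐ[D] L`),
and BC-0′ (`SplittingBase.localization_adjoinRoot_localEtale_bundle`) transports to the
**LOCAL-ÉTALE BUNDLE `fibreGerm_bundle`** for `D → L` (algebra structure `fibreGermAlgebra`, the
inclusion along `K → K_g`): local, Noetherian, flat, formally unramified, essentially of finite
type, `𝔪_D·L = 𝔪_L`, `κ(L)/κ(D)` finite separable, `dim L = dim D`, `L` regular iff `D` regular —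
the hypothesis list of the named facts `Lipman1969_16_1_ii` / `Lipman1969_16_5`, which are then
consumed as HYPOTHESES (`hasRationalSingularity_fibreGerm`, `isResolution_pullback_fibreGerm`).

`L` is a variable subring, so the `D`-algebra structure is a `def` to be brought in with `letI`
(no global instance is possible).  OURS (cell res-hironaka, chain W4.4); AI-written, weaker than
expert review; nothing here is a statement of the manuscript under review (Hironaka 2017); no
Theses file is imported.
-/

noncomputable section

set_option linter.dupNamespace false

open IsLocalRing Polynomial

namespace Summit.ResolutionOfSingularities.ResolutionOfSingularities.Theorems.NoZeno.SplittingBase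

variable {k K : Type} [Field k] [Field K] [Algebra k K]

section FibreGerm

variable (D : Subalgebra k K) (f : (↥D)[X]) (g : K[X]) (hg : f.map (algebraMap ↥D K) = g)
  (L : Subring (AdjoinRoot g)) (hML : (liftModel D f g hg).toSubring ≤ L)

/-- **The base-change map `D → L`** (inclusion along `K → K_g`). [this work] -/
def toFibreGerm : ↥D →+* ↥L :=
  ((algebraMap K (AdjoinRoot g)).comp D.val.toRingHom).codRestrict _
    fun d => hML (Subalgebra.mem_toSubring.mpr (algebraMap_mem_liftModel D f g hg d.2))

/-- `toFibreGerm` on elements. [this work] -/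
theorem coe_toFibreGerm (d : ↥D) :
    ((toFibreGerm D f g hg L hML d : ↥L) : AdjoinRoot g) = algebraMap K (AdjoinRoot g) (d : K) := rfl

/-- `L` as a `D`-algebra (a `def`: bring it in with `letI`). [this work] -/
@[reducible] def fibreGermAlgebra : Algebra ↥D ↥L := (toFibreGerm D f g hg L hML).toAlgebra

/-- `D[X]/(f) → L` (`liftHom` with values in `L`). [this work] -/
def liftToFibreGerm : AdjoinRoot f →+* ↥L :=
  (liftHom D f g hg).toRingHom.codRestrict _ fun x => hML (Subalgebra.mem_toSubring.mpr ⟨x, rfl⟩)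

/-- `liftToFibreGerm` on elements. [this work] -/
theorem coe_liftToFibreGerm (x : AdjoinRoot f) :
    ((liftToFibreGerm D f g hg L hML x : ↥L) : AdjoinRoot g) = liftHom D f g hg x := rfl

/-- `liftToFibreGerm ∘ (D → D[X]/(f)) = toFibreGerm`. [this work] -/
theorem liftToFibreGerm_of (d : ↥D) :
    liftToFibreGerm D f g hg L hML (AdjoinRoot.of f d) = toFibreGerm D f g hg L hML d :=
  Subtype.ext (by rw [coe_liftToFibreGerm, liftHom_of]; rfl)

variable [IsLocalRing ↥L]

/-- **The prime of `D[X]/(f)` cut out by `L`**: the preimage of the non-units. [this work] -/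
def fibrePrime : Ideal (AdjoinRoot f) := (maximalIdeal ↥L).comap (liftToFibreGerm D f g hg L hML)

/-- `fibrePrime` is prime. [this work] -/
instance isPrime_fibrePrime : (fibrePrime D f g hg L hML).IsPrime := Ideal.comap_isPrime _ _

/-- Membership in `fibrePrime`: `x ∈ 𝔫 ↔ x` is a non-unit of `L`. [this work] -/
theorem mem_fibrePrime_iff (x : AdjoinRoot f) :
    x ∈ fibrePrime D f g hg L hML ↔ ¬ IsUnit (liftToFibreGerm D f g hg L hML x) := by
  rw [fibrePrime, Ideal.mem_comap, mem_maximalIdeal, mem_nonunits_iff]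

variable (hfrac : ∀ z : ↥L, ∃ a b : AdjoinRoot f, IsUnit (liftToFibreGerm D f g hg L hML b) ∧
    (z : AdjoinRoot g) * liftHom D f g hg b = liftHom D f g hg a)

include hfrac in
/-- **`L` is the localisation `(D[X]/(f))_𝔫`** (for the algebra structure `liftToFibreGerm`), under
(ii) written as «`z · b = a` with `b` a unit of `L`». [this work] -/
theorem isLocalization_fibreGerm (hf : f.Monic) :
    @IsLocalization.AtPrime _ _ ↥L _ (liftToFibreGerm D f g hg L hML).toAlgebra
      (fibrePrime D f g hg L hML) _ := by
  letI : Algebra (AdjoinRoot f) ↥L := (liftToFibreGerm D f g hg L hML).toAlgebra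
  have halg : ∀ x, algebraMap (AdjoinRoot f) ↥L x = liftToFibreGerm D f g hg L hML x := fun _ => rfl
  refine (isLocalization_iff _ _).mpr ⟨?_, ?_, ?_⟩
  · rintro ⟨y, hy⟩
    have hy' : y ∉ fibrePrime D f g hg L hML := hy
    rwa [mem_fibrePrime_iff, not_not] at hy'
  · intro z
    obtain ⟨a, b, hb, hz⟩ := hfrac z
    have hb' : b ∉ fibrePrime D f g hg L hML := by rwa [mem_fibrePrime_iff, not_not]
    exact ⟨(a, ⟨b, hb'⟩), Subtype.ext hz⟩
  · intro x y hxy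
    refine ⟨1, ?_⟩
    have h : liftHom D f g hg x = liftHom D f g hg y := by
      have := congrArg (fun z : ↥L => (z : AdjoinRoot g)) hxy
      simpa [halg, coe_liftToFibreGerm] using this
    rw [liftHom_injective D f g hg hf h]

include hfrac in
/-- **`(D[X]/(f))_𝔫 ≃ₐ[D] L`.** [this work] -/
def fibreGermEquiv (hf : f.Monic) :
    letI := fibreGermAlgebra D f g hg L hML
    Localization.AtPrime (fibrePrime D f g hg L hML) ≃ₐ[↥D] ↥L := by
  letI := fibreGermAlgebra D f g hg L hML
  letI : Algebra (AdjoinRoot f) ↥L := (liftToFibreGerm D f g hg L hML).toAlgebra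
  haveI := isLocalization_fibreGerm D f g hg L hML hfrac hf
  haveI : IsScalarTower ↥D (AdjoinRoot f) ↥L := IsScalarTower.of_algebraMap_eq fun d =>
    (liftToFibreGerm_of D f g hg L hML d).symm
  exact (IsLocalization.algEquiv (fibrePrime D f g hg L hML).primeCompl
    (Localization.AtPrime (fibrePrime D f g hg L hML)) ↥L).restrictScalars ↥D

variable [IsLocalRing ↥D]
  (hloc : ∀ d : ↥D, d ∈ maximalIdeal ↥D → ¬ IsUnit (toFibreGerm D f g hg L hML d))

include hloc in
/-- Under (iii), `fibrePrime` lies over `𝔪_D`. [this work] -/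
theorem comap_fibrePrime_eq :
    (fibrePrime D f g hg L hML).comap (algebraMap ↥D (AdjoinRoot f)) = maximalIdeal ↥D := by
  refine le_antisymm (IsLocalRing.le_maximalIdeal fun h => ?_) fun d hd => ?_
  · have h1 : (1 : ↥D) ∈ (fibrePrime D f g hg L hML).comap (algebraMap ↥D (AdjoinRoot f)) :=
      h ▸ Submodule.mem_top
    rw [Ideal.mem_comap, map_one, mem_fibrePrime_iff, map_one] at h1
    exact h1 isUnit_one
  · rw [Ideal.mem_comap, AdjoinRoot.algebraMap_eq, mem_fibrePrime_iff, liftToFibreGerm_of]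
    exact hloc d hd

include hloc in
/-- Under (iii), `fibrePrime` is a maximal ideal (`D[X]/(f)` is integral over `D`, `f` monic).
[this work] -/
theorem isMaximal_fibrePrime (hf : f.Monic) : (fibrePrime D f g hg L hML).IsMaximal := by
  haveI := hf.finite_adjoinRoot
  exact Ideal.isMaximal_of_isIntegral_of_isMaximal_comap (R := ↥D) _
    ((comap_fibrePrime_eq D f g hg L hML hloc).symm ▸ maximalIdeal.isMaximal ↥D)

include hloc hfrac in
/-- **THE LOCAL-ÉTALE BUNDLE for `D → L`** (hypotheses of `Lipman1969_16_1_ii` / `_16_5`):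
`D` Noetherian local, `f` monic with separable reduction, `L` a local ring of `D[β]` dominating `D`
((i)–(iii)). [this work] -/
theorem fibreGerm_bundle [IsNoetherianRing ↥D] (hf : f.Monic) (hsep : (f.map (residue ↥D)).Separable) :
    letI := fibreGermAlgebra D f g hg L hML
    ∃ (_ : IsLocalHom (algebraMap ↥D ↥L)),
      IsNoetherianRing ↥L ∧ Module.Flat ↥D ↥L ∧ Algebra.FormallyUnramified ↥D ↥L ∧
      Algebra.EssFiniteType ↥D ↥L ∧
      (maximalIdeal ↥D).map (algebraMap ↥D ↥L) = maximalIdeal ↥L ∧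
      Algebra.IsSeparable (ResidueField ↥D) (ResidueField ↥L) ∧
      Module.Finite (ResidueField ↥D) (ResidueField ↥L) ∧
      ringKrullDim ↥L = ringKrullDim ↥D ∧ (IsRegularLocalRing ↥L ↔ IsRegularLocalRing ↥D) := by
  letI := fibreGermAlgebra D f g hg L hML
  haveI := isMaximal_fibrePrime D f g hg L hML hloc hf
  set 𝔫 := fibrePrime D f g hg L hML with h𝔫
  obtain ⟨hN, hlh, hfl, hur, heft, hm, hsepκ, hfinκ, hdim, hreg⟩ :=
    localization_adjoinRoot_localEtale_bundle hf hsep 𝔫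
  let E := fibreGermEquiv D f g hg L hML hfrac hf
  have hcomp : algebraMap ↥D ↥L =
      E.toRingEquiv.toRingHom.comp (algebraMap ↥D (Localization.AtPrime 𝔫)) :=
    RingHom.ext fun d => (E.commutes d).symm
  -- `D → L` is local, directly from (iii)
  haveI hlhL : IsLocalHom (algebraMap ↥D ↥L) := ⟨fun d hd => by
    by_contra hnu
    exact hloc d ((mem_maximalIdeal _).mpr hnu) hd⟩
  refine ⟨hlhL, isNoetherianRing_of_ringEquiv _ E.toRingEquiv,
    Module.Flat.of_linearEquiv E.symm.toLinearEquiv, Algebra.FormallyUnramified.of_equiv E,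
    Algebra.EssFiniteType.of_surjective E.toAlgHom E.surjective, ?_,
    Algebra.IsSeparable.of_algHom (ResidueField ↥D) (ResidueField (Localization.AtPrime 𝔫))
      (ResidueField.mapAlgEquiv' E).symm.toAlgHom,
    Module.Finite.equiv (ResidueField.mapAlgEquiv' E).toLinearEquiv,
    (ringKrullDim_eq_of_ringEquiv E.toRingEquiv).symm.trans hdim,
    ⟨fun h => hreg.mp (IsRegularLocalRing.of_ringEquiv E.toRingEquiv.symm),
      fun h => by haveI := hreg.mpr h; exact IsRegularLocalRing.of_ringEquiv E.toRingEquiv⟩⟩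
  rw [hcomp, ← Ideal.map_map, hm]
  exact map_maximalIdeal_of_surjective _ E.surjective

/-! ### Consuming the named facts along `D → L` -/

open Literature.AlgebraicGeometry.Resolution CategoryTheory AlgebraicGeometry in
include hloc hfrac in
/-- **Rationality ascends to the fibre germ** (Lipman (16.5) as a hypothesis): `D` a normal
Noetherian local `k`-subalgebra of `K` of dimension two with a rational singularity ⇒ so is `L`
(and `L` is normal). [this work; conditional on the named fact `Lipman1969_16_5`] -/
theorem hasRationalSingularity_fibreGerm (h16_5 : Lipman1969_16_5.{0}) [IsNoetherianRing ↥D]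
    [IsIntegrallyClosed ↥D] (hf : f.Monic) (hsep : (f.map (residue ↥D)).Separable)
    (hdim : ringKrullDim ↥D = 2) (hrat : HasRationalSingularity ↥D) :
    IsIntegrallyClosed ↥L ∧ HasRationalSingularity ↥L := by
  letI := fibreGermAlgebra D f g hg L hML
  obtain ⟨hlh, hN, hfl, -, -, hm, hsepκ, -, hdim', -⟩ :=
    fibreGerm_bundle D f g hg L hML hfrac hloc hf hsep
  haveI := hlh; haveI := hN; haveI := hfl
  obtain ⟨X, gX, hgX, hH⟩ := hrat
  obtain ⟨hnorm, hiff⟩ := h16_5 ↥D ↥L inferInstance hm hsepκ hdim (hdim'.trans hdim) ⟨X, gX, hgX⟩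
  exact ⟨(hnorm.mp ⟨inferInstance, inferInstance⟩).2,
    (hiff ⟨inferInstance, inferInstance⟩).mp ⟨X, gX, hgX, hH⟩⟩

open Literature.AlgebraicGeometry.Resolution CategoryTheory AlgebraicGeometry in
include hloc hfrac in
/-- **Desingularisations pull back to the fibre germ** (Lipman (16.1)(ii) as a hypothesis), along
`Spec L → Spec D` induced by `toFibreGerm`. [this work; conditional on the named fact
`Lipman1969_16_1_ii`] -/
theorem isResolution_pullback_fibreGerm (h16_1 : Lipman1969_16_1_ii.{0}) [IsNoetherianRing ↥D]
    (hf : f.Monic) (hsep : (f.map (residue ↥D)).Separable) {Y : Scheme.{0}}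
    (gY : Y ⟶ Spec (.of ↥D)) (hgY : IsResolution gY) :
    IsResolution (Limits.pullback.snd gY (Spec.map (CommRingCat.ofHom (toFibreGerm D f g hg L hML)))) := by
  letI := fibreGermAlgebra D f g hg L hML
  obtain ⟨hlh, hN, hfl, -, -, hm, hsepκ, -, -, -⟩ :=
    fibreGerm_bundle D f g hg L hML hfrac hloc hf hsep
  haveI := hlh; haveI := hN; haveI := hfl
  exact (h16_1 ↥D ↥L inferInstance hm hsepκ Y gY hgY).2

end FibreGerm

end Summit.ResolutionOfSingularities.ResolutionOfSingularities.Theorems.NoZeno.SplittingBase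

end
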